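import Literature.Analysis.FluidPDE.KNSSRegularityDecomposition
import Literature.Analysis.FluidPDE.OseenHeatSemigroup
import HarnessLib

/-!
# The Oseen–Duhamel integral with bounded measurable forcing: measurability, bounds,
# continuity, restart

Analysis/FluidPDE support file (everything proved; no named facts) on the discharge path of
`Literature.Analysis.FluidPDE.KNSS2009_regularity_boundedWeak_window` (Koch–Nadirashvili–
Seregin–Šverák 2009, §4) through `KNSSRegularityDecomposition.lean`: both halves
`KNSS2009_weak_driftMild` and `KNSS2009_driftMild_regularity` manipulate the Duhamel term
`driftDuhamel U b s t x = ∫ₛᵗ ∑ᵢ (𝒩_{t−σ}[(U+b) ⊗ (U+b)](σ))ᵢ(x) eᵢ dσ` (`𝒩_τ = oseenHeat τ`,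
`e = stdOrthonormalBasis ℝ E`) whose forcing `σ ↦ (U(σ) + b(σ)) ⊗ (U(σ) + b(σ))` is only
**bounded and jointly measurable** in `(σ, y)` — the parasitic drift `b(t)` of KNSS's Lemma 3.1 is
an arbitrary bounded measurable function of time (KNSS §1 p. 3), so no continuity in `σ` is
available. This file supplies the sup-norm calculus of such Duhamel integrals in dimension three,
for a general jointly measurable matrix forcing `F : ℝ → (j k ↦ E → ℝ)` bounded by `B` on the
relevant time interval, and its specialisation to `driftTensor`/`driftDuhamel`:

* measurability of the integrand `σ ↦ (𝒩_{t−σ}F(σ))ᵢ(x)` at a **fixed** point `x`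
  (`aestronglyMeasurable_oseenHeat_sub_section`: write `𝒩_{t−σ} = e^{((t−σ)/2)Δ}𝒩_{(t−σ)/2}` and
  integrate the jointly measurable `(σ, y) ↦ G_{(t−σ)/2}(x − y)(𝒩_{(t−σ)/2}F(σ))ᵢ(y)` in `y`; the
  tree's `aestronglyMeasurable_oseenHeat_param` gives joint measurability in `(σ, y)`);
* the size bound `‖𝒩_{t−σ}F(σ)(x)‖ ≤ 8829 (t−σ)^{-1/2} B`, interval integrability, and
  `‖∫ₛᵗ 𝒩_{t−σ}F(σ)(x) dσ‖ ≤ 17658 B (t−s)^{1/2}` (`norm_integral_sum_oseenHeat_sub_smul_le`);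
* continuity in `x` (dominated convergence), Hölder-`1/2` continuity in `t` uniformly in `x`
  (`norm_integral_sum_oseenHeat_duhamel_sub_le`, from the tree's modulus of continuity of `𝒩_τ`
  in `τ`), hence **joint continuity** of `(t, x) ↦ ∫ₛᵗ 𝒩_{t−σ}F(σ)(x) dσ` on `[s, T] × E`
  (`continuousOn_integral_sum_oseenHeat_duhamel_prod`) — the source of Borel measurability of
  the representative `U` in Lemma 3.1;
* the **restart identity** `∫ᵣᵗ 𝒩_{t−σ}F dσ = e^{(t−s)Δ}(∫ᵣˢ 𝒩_{s−σ}F dσ) + ∫ₛᵗ 𝒩_{t−σ}F dσ`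
  (`integral_sum_oseenHeat_duhamel_eq_heatExtension_add`: Fubini in `(y, σ)` with the majorant
  `G_{t−s}(x−y) · 8829 (s−σ)^{-1/2} B`, then the tree's semigroup law `heatExtension_oseenHeat`
  componentwise) — KNSS 2009, §4 p. 8: (4.4) "can be treated as an ODE in `t`";
* a.e.-congruence: `𝒩_τ F` and the Duhamel integral only see the a.e. class of `F(σ)` for a.e.
  `σ` (`integral_sum_oseenHeat_duhamel_congr_ae`), which is how `u ⊗ u` is replaced by
  `(U + b) ⊗ (U + b)` when `u = U + b` a.e.;
* for a drift-mild pair (`IsKNSSDriftMild T N U b`): the tensor bound `4N²`, continuity of every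
  slice `U(t, ·)` in the open window (`IsKNSSDriftMild.continuous_slice`), joint continuity and
  restart of `driftDuhamel` (`IsKNSSDriftMild.continuousOn_driftDuhamel_prod`,
  `IsKNSSDriftMild.driftDuhamel_eq_heatExtension_add`).

Numerical constants are inherited from `OseenHeat`/`OseenHeatSemigroup` and not optimised.

## Mathlib / tree search

Tree: `oseenHeat`, `norm_oseenHeat_le_of_top`, `aestronglyMeasurable_oseenHeat_param`,
`aestronglyMeasurable_oseenHeat`, `oseenHeat_eq_heatExtension`, `contDiff_oseenHeat`,
`heatExtension_oseenHeat`, `norm_oseenHeat_sub_le` (modulus in `τ`), `exists_componentwise_bound`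
(`OseenHeat`, `OseenHeatSemigroup`); `heatExtension_eq_integral_sub`, `integrable_heatKernel_holds`,
`heatKernel_pos`, `continuous_heatKernel`, `contDiff_heatExtension_holds` (`HeatKernel*`). The
closest neighbour is the queued `OseenDuhamel.lean` (`oseenVec`, `oseenDuhamel ν F t x` from time
`0`, for *continuous* forcings `IsBddCtsForcing`) of the Leray `L^∞` programme, and
`NSBoundedMildOseen.lean`'s `oseenDuhamel` over the pointwise kernel `oseenKernel`
(`KochTataru.lean`, `OseenKernelSemigroup.lean`); neither covers measurable-in-time forcings or the
two-time integral `∫ₛᵗ`, and no `oseenHeat ↔ oseenKernel` bridge exists, so the statements here are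
written directly for the inline vector `∑ᵢ (oseenHeat τ F i x) • eᵢ` used by `driftDuhamel`
(`lean search 'driftDuhamel|oseenHeat \(t -|oseenHeat \(.* - '`: only the decomposition file).
Mathlib: `intervalIntegral.continuous_of_dominated_interval`, `integral_integral_swap`,
`Integrable.mul_prod`, `AEStronglyMeasurable.integral_prod_right'`, `intervalIntegrable_rpow'`,
`integral_rpow`, `intervalIntegral.norm_integral_le_of_norm_le`,
`intervalIntegral.integral_add_adjacent_intervals`, `memLp_top_of_bound`.

## References

* G. Koch, N. Nadirashvili, G. Seregin, V. Šverák, *Liouville theorems for the Navier–Stokes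
  equations and applications*, Acta Math. 203 (2009) = arXiv:0709.3599v1, §3 (3.3)–(3.7),
  Lemma 3.1; §4 (4.3)–(4.4) and p. 8. [KochNadirashviliSereginSverak2009]
* P. G. Lemarié-Rieusset, *The Navier–Stokes Problem in the 21st Century*, CRC 2016, §6.2,
  Prop. 6.4 (the Oseen tensor as a semigroup). [LemarieRieusset2016]
-/

open MeasureTheory Filter Topology Set InnerProductSpace Metric Function
open scoped Real ENNReal NNReal Convolution Laplacian RealInnerProductSpace ContDiff

noncomputable section

namespace Literature.Analysis.FluidPDE

section Slices

variable {E : Type*} [NormedAddCommGroup E] [InnerProductSpace ℝ E] [FiniteDimensional ℝ E]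

/-- `|⟪v, eⱼ⟫| ≤ ‖v‖` for the frame `e = stdOrthonormalBasis ℝ E`. [folklore] -/
theorem abs_inner_stdOrthonormalBasis_le (v : E) (j : Fin (Module.finrank ℝ E)) :
    |⟪v, stdOrthonormalBasis ℝ E j⟫| ≤ ‖v‖ := by
  refine (abs_real_inner_le_norm _ _).trans ?_
  have := norm_stdOrthonormalBasis_le_one (E := E) j
  nlinarith [norm_nonneg v]

/-- `‖∑ᵢ aᵢ eᵢ‖ ≤ ∑ᵢ |aᵢ|` for the frame `e = stdOrthonormalBasis ℝ E`. [folklore] -/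
theorem norm_sum_smul_stdOrthonormalBasis_le (a : Fin (Module.finrank ℝ E) → ℝ) :
    ‖∑ i, a i • stdOrthonormalBasis ℝ E i‖ ≤ ∑ i, |a i| := by
  refine (norm_sum_le _ _).trans (Finset.sum_le_sum fun i _ => ?_)
  rw [norm_smul, Real.norm_eq_abs]
  have := norm_stdOrthonormalBasis_le_one (E := E) i
  nlinarith [abs_nonneg (a i)]

variable [MeasurableSpace E] [BorelSpace E]

variable {F : ℝ → Fin (Module.finrank ℝ E) → Fin (Module.finrank ℝ E) → E → ℝ}

/-- A time slice of a jointly measurable, bounded matrix forcing is in `L^∞` with the same bound.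
[folklore] -/
theorem memLp_top_slice_of_bound (hmeas : ∀ j k, Measurable fun q : ℝ × E => F q.1 j k q.2)
    {B : ℝ} {σ : ℝ} (hB : ∀ j k y, |F σ j k y| ≤ B) (j k : Fin (Module.finrank ℝ E)) :
    MemLp (F σ j k) ∞ volume ∧ eLpNorm (F σ j k) ∞ volume ≤ ENNReal.ofReal B := by
  have hm : AEStronglyMeasurable (F σ j k) volume :=
    ((hmeas j k).comp (measurable_const.prodMk measurable_id)).aestronglyMeasurable
  have hb : ∀ᵐ y ∂(volume : Measure E), ‖F σ j k y‖ ≤ B :=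
    Eventually.of_forall fun y => by rw [Real.norm_eq_abs]; exact hB j k y
  exact ⟨memLp_top_of_bound hm B hb, by
    rw [eLpNorm_exponent_top]; exact eLpNormEssSup_le_of_ae_bound hb⟩

end Slices

/-! ## The kernel weight `(t − σ)^{-1/2}` -/

section Weight

/-- The kernel weight `σ ↦ (t − σ)^{-1/2}` is interval integrable on every interval (exponent
`> −1`). [folklore] -/
theorem intervalIntegrable_rpow_neg_half_sub (a b t : ℝ) :
    IntervalIntegrable (fun σ : ℝ => (t - σ) ^ (-(1 / 2 : ℝ))) volume a b := by
  have h := (intervalIntegral.intervalIntegrable_rpow' (a := t - a) (b := t - b)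
    (by norm_num : (-1 : ℝ) < -(1 / 2))).comp_sub_left t
  simpa using h

/-- `∫ₛᵗ (t − σ)^{-1/2} dσ = 2 (t − s)^{1/2}` (for `t < s` both sides carry the same `rpow` junk).
[folklore] -/
theorem integral_rpow_neg_half_sub_eq (s t : ℝ) :
    ∫ σ in s..t, (t - σ) ^ (-(1 / 2 : ℝ)) = 2 * (t - s) ^ (1 / 2 : ℝ) := by
  rw [intervalIntegral.integral_comp_sub_left (fun σ => σ ^ (-(1 / 2 : ℝ))) t, sub_self,
    integral_rpow (Or.inl (by norm_num : (-1 : ℝ) < -(1 / 2)))]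
  rw [show (-(1 / 2 : ℝ)) + 1 = 1 / 2 by norm_num, Real.zero_rpow (by norm_num : (1 / 2 : ℝ) ≠ 0)]
  ring

/-- An everywhere-on-`Ioo s t` statement holds a.e. on `Ioc s t` (the endpoint is null).
[folklore] -/
theorem ae_mem_Ioc_of_forall_Ioo {P : ℝ → Prop} {s t : ℝ} (h : ∀ σ ∈ Ioo s t, P σ) :
    ∀ᵐ σ ∂(volume : Measure ℝ), σ ∈ Ioc s t → P σ := by
  have : ∀ᵐ σ ∂(volume : Measure ℝ), σ ≠ t := by
    have h0 : (volume : Measure ℝ) {t} = 0 := measure_singleton t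
    exact (ae_iff.2 (by simp [h0]))
  filter_upwards [this] with σ hσ hmem
  exact h σ ⟨hmem.1, lt_of_le_of_ne hmem.2 hσ⟩

end Weight

/-! ## Measurability and bounds of the Duhamel integrand `σ ↦ 𝒩_{t−σ} F(σ)` -/

section Integrand

variable {E : Type*} [NormedAddCommGroup E] [InnerProductSpace ℝ E] [FiniteDimensional ℝ E]
  [MeasurableSpace E] [BorelSpace E]

variable (hE : Module.finrank ℝ E = 3)
include hE

variable {F : ℝ → Fin (Module.finrank ℝ E) → Fin (Module.finrank ℝ E) → E → ℝ}

omit hE in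
/-- **Joint measurability of `(σ, x) ↦ (𝒩_{c(σ)} F(σ))ᵢ(x)`** on `S × E` for a jointly measurable
matrix forcing bounded on the measurable time set `S` and a measurable clock `c > 0` on `S`
(the tree's `aestronglyMeasurable_oseenHeat_param`). [folklore] -/
theorem aestronglyMeasurable_oseenHeat_clock_prod
    (hmeas : ∀ j k, Measurable fun q : ℝ × E => F q.1 j k q.2) {S : Set ℝ} (hS : MeasurableSet S)
    {B : ℝ} (hB : ∀ σ ∈ S, ∀ j k y, |F σ j k y| ≤ B) {c : ℝ → ℝ} (hc : Measurable c)
    (hcpos : ∀ σ ∈ S, 0 < c σ) (i : Fin (Module.finrank ℝ E)) :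
    AEStronglyMeasurable (fun q : ℝ × E => oseenHeat (c q.1) (F q.1) i q.2)
      ((volume.restrict S).prod (volume : Measure E)) := by
  have hG : ∀ j k, AEStronglyMeasurable (fun q : ℝ × E => F q.1 j k q.2)
      ((volume.restrict S).prod (volume : Measure E)) := fun j k => (hmeas j k).aestronglyMeasurable
  have hGp : ∀ᵐ σ ∂(volume.restrict S), 0 < c σ ∧ ∀ j k, MemLp (fun y => F σ j k y) ∞ volume :=
    (ae_restrict_iff' hS).2 (Eventually.of_forall fun σ hσ =>
      ⟨hcpos σ hσ, fun j k => (memLp_top_slice_of_bound hmeas (hB σ hσ) j k).1⟩)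
  exact aestronglyMeasurable_oseenHeat_param hc hG le_top hGp i

/-- **Measurability of the Duhamel integrand at a fixed point**: for every `x`,
`σ ↦ (𝒩_{t−σ} F(σ))ᵢ(x)` is a.e. strongly measurable on any measurable `S ⊆ (−∞, t)` on which the
forcing is bounded. (Write `𝒩_{t−σ} = e^{((t−σ)/2)Δ} 𝒩_{(t−σ)/2}` and integrate the jointly
measurable `(σ, y) ↦ G_{(t−σ)/2}(x − y) (𝒩_{(t−σ)/2} F(σ))ᵢ(y)` in `y`.) [folklore] -/
theorem aestronglyMeasurable_oseenHeat_sub_section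
    (hmeas : ∀ j k, Measurable fun q : ℝ × E => F q.1 j k q.2) {S : Set ℝ} (hS : MeasurableSet S)
    {t : ℝ} (hSt : ∀ σ ∈ S, σ < t) {B : ℝ} (hB : ∀ σ ∈ S, ∀ j k y, |F σ j k y| ≤ B)
    (i : Fin (Module.finrank ℝ E)) (x : E) :
    AEStronglyMeasurable (fun σ => oseenHeat (t - σ) (F σ) i x) (volume.restrict S) := by
  -- the half clock and the kernel at the complementary half
  set c : ℝ → ℝ := fun σ => (t - σ) / 2 with hc
  have hcm : Measurable c := (measurable_const.sub measurable_id).div_const 2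
  have hcpos : ∀ σ ∈ S, 0 < c σ := fun σ hσ => by rw [hc]; dsimp only; linarith [hSt σ hσ]
  have hL := aestronglyMeasurable_oseenHeat_clock_prod hmeas hS hB hcm hcpos i
  have hK : Measurable (fun q : ℝ × E => UnboundedOperators.heatKernel q.1 q.2) := by
    unfold UnboundedOperators.heatKernel
    fun_prop
  have hk0 : Measurable (fun q : ℝ × E => UnboundedOperators.heatKernel (t - q.1 - c q.1) (x - q.2)) :=
    hK.comp (((measurable_const.sub measurable_fst).sub (hcm.comp measurable_fst)).prodMk
      (measurable_const.sub measurable_snd))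
  have hk : AEStronglyMeasurable (fun q : ℝ × E =>
      UnboundedOperators.heatKernel (t - q.1 - c q.1) (x - q.2) * oseenHeat (c q.1) (F q.1) i q.2)
      ((volume.restrict S).prod (volume : Measure E)) := hk0.aestronglyMeasurable.mul hL
  have hint : AEStronglyMeasurable (fun σ => ∫ y, UnboundedOperators.heatKernel (t - σ - c σ) (x - y) *
      oseenHeat (c σ) (F σ) i y) (volume.restrict S) := hk.integral_prod_right'
  refine hint.congr ((ae_restrict_iff' hS).2 (Eventually.of_forall fun σ hσ => ?_))
  have hF : ∀ j k, MemLp (F σ j k) ∞ volume := fun j k => (memLp_top_slice_of_bound hmeas (hB σ hσ) j k).1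
  have h1 : 0 < c σ := hcpos σ hσ
  have h2 : c σ < t - σ := by rw [hc]; dsimp only; linarith [hSt σ hσ]
  dsimp only
  rw [oseenHeat_eq_heatExtension hE hF h1 h2 i, UnboundedOperators.heatExtension_eq_integral_sub]
  simp only [smul_eq_mul]

/-- **Size of the Duhamel integrand**: `|(𝒩_{t−σ} F(σ))ᵢ(x)| ≤ 2943 (t−σ)^{-1/2} B` for `σ < t`
when `|F(σ)ⱼₖ| ≤ B`. [folklore] -/
theorem norm_oseenHeat_duhamelIntegrand_le (hmeas : ∀ j k, Measurable fun q : ℝ × E => F q.1 j k q.2)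
    {B : ℝ} (hB0 : 0 ≤ B) {σ t : ℝ} (hσt : σ < t) (hB : ∀ j k y, |F σ j k y| ≤ B)
    (i : Fin (Module.finrank ℝ E)) (x : E) :
    ‖oseenHeat (t - σ) (F σ) i x‖ ≤ 2943 * (t - σ) ^ (-(1 / 2 : ℝ)) * B :=
  norm_oseenHeat_le_of_top hE (fun j k => (memLp_top_slice_of_bound hmeas hB j k).1) hB0
    (fun j k => (memLp_top_slice_of_bound hmeas hB j k).2) (sub_pos.2 hσt) i x

/-- Vector form of the size bound: `‖∑ᵢ (𝒩_{t−σ} F(σ))ᵢ(x) eᵢ‖ ≤ 8829 (t−σ)^{-1/2} B`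
(`3 · 2943`). [folklore] -/
theorem norm_sum_oseenHeat_duhamelIntegrand_smul_le (hmeas : ∀ j k, Measurable fun q : ℝ × E => F q.1 j k q.2)
    {B : ℝ} (hB0 : 0 ≤ B) {σ t : ℝ} (hσt : σ < t) (hB : ∀ j k y, |F σ j k y| ≤ B) (x : E) :
    ‖∑ i, oseenHeat (t - σ) (F σ) i x • stdOrthonormalBasis ℝ E i‖ ≤
      8829 * (t - σ) ^ (-(1 / 2 : ℝ)) * B := by
  refine (norm_sum_smul_stdOrthonormalBasis_le _).trans ?_
  calc ∑ i, |oseenHeat (t - σ) (F σ) i x|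
      ≤ ∑ _i : Fin (Module.finrank ℝ E), 2943 * (t - σ) ^ (-(1 / 2 : ℝ)) * B :=
        Finset.sum_le_sum fun i _ => by
          rw [← Real.norm_eq_abs]; exact norm_oseenHeat_duhamelIntegrand_le hE hmeas hB0 hσt hB i x
    _ = 8829 * (t - σ) ^ (-(1 / 2 : ℝ)) * B := by
        rw [Finset.sum_const, Finset.card_univ, Fintype.card_fin, hE, nsmul_eq_mul]
        push_cast
        ring

/-- **The Duhamel integrand is interval integrable** on `[s, t]` when the forcing is jointly
measurable and bounded on `(s, t)`. [folklore] -/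
theorem intervalIntegrable_sum_oseenHeat_sub_smul
    (hmeas : ∀ j k, Measurable fun q : ℝ × E => F q.1 j k q.2) {B : ℝ} (hB0 : 0 ≤ B) {s t : ℝ}
    (hst : s ≤ t) (hB : ∀ σ ∈ Ioo s t, ∀ j k y, |F σ j k y| ≤ B) (x : E) :
    IntervalIntegrable (fun σ => ∑ i, oseenHeat (t - σ) (F σ) i x • stdOrthonormalBasis ℝ E i)
      volume s t := by
  rw [intervalIntegrable_iff_integrableOn_Ioo_of_le hst]
  have hm : AEStronglyMeasurable (fun σ => ∑ i, oseenHeat (t - σ) (F σ) i x •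
      stdOrthonormalBasis ℝ E i) (volume.restrict (Ioo s t)) :=
    Finset.aestronglyMeasurable_fun_sum _ fun i _ =>
      (aestronglyMeasurable_oseenHeat_sub_section hE hmeas measurableSet_Ioo (fun σ hσ => hσ.2) hB
        i x).smul_const _
  have hw : IntegrableOn (fun σ : ℝ => 8829 * (t - σ) ^ (-(1 / 2 : ℝ)) * B) (Ioo s t) := by
    have := ((intervalIntegrable_rpow_neg_half_sub s t t).const_mul 8829).mul_const B
    exact (intervalIntegrable_iff_integrableOn_Ioo_of_le hst).1 this
  refine Integrable.mono' hw hm ((ae_restrict_iff' measurableSet_Ioo).2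
    (Eventually.of_forall fun σ hσ => ?_))
  exact norm_sum_oseenHeat_duhamelIntegrand_smul_le hE hmeas hB0 hσ.2 (hB σ hσ) x

/-- **Size of the Duhamel integral**: `‖∫ₛᵗ 𝒩_{t−σ} F(σ)(x) dσ‖ ≤ 17658 B (t − s)^{1/2}`.
[folklore] -/
theorem norm_integral_sum_oseenHeat_sub_smul_le
    (hmeas : ∀ j k, Measurable fun q : ℝ × E => F q.1 j k q.2) {B : ℝ} (hB0 : 0 ≤ B) {s t : ℝ}
    (hst : s ≤ t) (hB : ∀ σ ∈ Ioo s t, ∀ j k y, |F σ j k y| ≤ B) (x : E) :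
    ‖∫ σ in s..t, ∑ i, oseenHeat (t - σ) (F σ) i x • stdOrthonormalBasis ℝ E i‖ ≤
      17658 * B * (t - s) ^ (1 / 2 : ℝ) := by
  have h := intervalIntegral.norm_integral_le_of_norm_le (μ := volume) (a := s) (b := t)
    (f := fun σ => ∑ i, oseenHeat (t - σ) (F σ) i x • stdOrthonormalBasis ℝ E i)
    (g := fun σ : ℝ => 8829 * (t - σ) ^ (-(1 / 2 : ℝ)) * B) hst ?_
    (((intervalIntegrable_rpow_neg_half_sub s t t).const_mul 8829).mul_const B)
  · refine h.trans (le_of_eq ?_)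
    rw [intervalIntegral.integral_mul_const, intervalIntegral.integral_const_mul,
      integral_rpow_neg_half_sub_eq s t]
    ring
  · exact ae_mem_Ioc_of_forall_Ioo fun σ hσ =>
      norm_sum_oseenHeat_duhamelIntegrand_smul_le hE hmeas hB0 hσ.2 (hB σ hσ) x

/-- **Continuity in space of the Duhamel integral** `x ↦ ∫ₛᵗ 𝒩_{t−σ} F(σ)(x) dσ` (dominated
convergence: the integrand is smooth in `x` for `σ < t` and dominated by `8829 (t−σ)^{-1/2} B`).
[folklore] -/
theorem continuous_integral_sum_oseenHeat_duhamel
    (hmeas : ∀ j k, Measurable fun q : ℝ × E => F q.1 j k q.2) {B : ℝ} (hB0 : 0 ≤ B) {s t : ℝ}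
    (hst : s ≤ t) (hB : ∀ σ ∈ Ioo s t, ∀ j k y, |F σ j k y| ≤ B) :
    Continuous fun x => ∫ σ in s..t, ∑ i, oseenHeat (t - σ) (F σ) i x • stdOrthonormalBasis ℝ E i := by
  refine intervalIntegral.continuous_of_dominated_interval
    (F := fun x σ => ∑ i, oseenHeat (t - σ) (F σ) i x • stdOrthonormalBasis ℝ E i)
    (bound := fun σ => 8829 * (t - σ) ^ (-(1 / 2 : ℝ)) * B) (fun x => ?_) (fun x => ?_)
    (((intervalIntegrable_rpow_neg_half_sub s t t).const_mul 8829).mul_const B) ?_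
  · rw [uIoc_of_le hst, ← Measure.restrict_congr_set Ioo_ae_eq_Ioc]
    exact Finset.aestronglyMeasurable_fun_sum _ fun i _ =>
      (aestronglyMeasurable_oseenHeat_sub_section hE hmeas measurableSet_Ioo (fun σ hσ => hσ.2) hB
        i x).smul_const _
  · rw [uIoc_of_le hst]
    exact ae_mem_Ioc_of_forall_Ioo fun σ hσ =>
      norm_sum_oseenHeat_duhamelIntegrand_smul_le hE hmeas hB0 hσ.2 (hB σ hσ) x
  · rw [uIoc_of_le hst]
    refine ae_mem_Ioc_of_forall_Ioo fun σ hσ => ?_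
    have hF : ∀ j k, MemLp (F σ j k) ∞ volume := fun j k =>
      (memLp_top_slice_of_bound hmeas (hB σ hσ) j k).1
    exact continuous_finsetSum _ fun i _ =>
      (contDiff_oseenHeat hE hF (sub_pos.2 hσ.2) i (n := 0)).continuous.smul continuous_const

/-- Integrability of the Duhamel integrand with a *later* observation time: for `r ≤ s ≤ t`,
`σ ↦ 𝒩_{t−σ} F(σ)(x)` is interval integrable on `[r, s]` when `F` is bounded on `(r, s)`.
[folklore] -/
theorem intervalIntegrable_sum_oseenHeat_sub_smul_of_le
    (hmeas : ∀ j k, Measurable fun q : ℝ × E => F q.1 j k q.2) {B : ℝ} (hB0 : 0 ≤ B) {r s t : ℝ}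
    (hrs : r ≤ s) (hst : s ≤ t) (hB : ∀ σ ∈ Ioo r s, ∀ j k y, |F σ j k y| ≤ B) (x : E) :
    IntervalIntegrable (fun σ => ∑ i, oseenHeat (t - σ) (F σ) i x • stdOrthonormalBasis ℝ E i)
      volume r s := by
  rw [intervalIntegrable_iff_integrableOn_Ioo_of_le hrs]
  have hm : AEStronglyMeasurable (fun σ => ∑ i, oseenHeat (t - σ) (F σ) i x •
      stdOrthonormalBasis ℝ E i) (volume.restrict (Ioo r s)) :=
    Finset.aestronglyMeasurable_fun_sum _ fun i _ =>
      (aestronglyMeasurable_oseenHeat_sub_section hE hmeas measurableSet_Ioo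
        (fun σ hσ => lt_of_lt_of_le hσ.2 hst) hB i x).smul_const _
  have hw : IntegrableOn (fun σ : ℝ => 8829 * (t - σ) ^ (-(1 / 2 : ℝ)) * B) (Ioo r s) := by
    have := ((intervalIntegrable_rpow_neg_half_sub r s t).const_mul 8829).mul_const B
    exact (intervalIntegrable_iff_integrableOn_Ioo_of_le hrs).1 this
  refine Integrable.mono' hw hm ((ae_restrict_iff' measurableSet_Ioo).2
    (Eventually.of_forall fun σ hσ => ?_))
  exact norm_sum_oseenHeat_duhamelIntegrand_smul_le hE hmeas hB0 (lt_of_lt_of_le hσ.2 hst) (hB σ hσ) x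

end Integrand

/-! ## Hölder continuity in time and joint continuity -/

section Time

variable {E : Type*} [NormedAddCommGroup E] [InnerProductSpace ℝ E] [FiniteDimensional ℝ E]
  [MeasurableSpace E] [BorelSpace E]

variable (hE : Module.finrank ℝ E = 3)
include hE

variable {F : ℝ → Fin (Module.finrank ℝ E) → Fin (Module.finrank ℝ E) → E → ℝ}

/-- Changing the observation time inside the Duhamel integrand:
`‖∑ᵢ ((𝒩_{t'−σ} − 𝒩_{t−σ}) F(σ))ᵢ(x) eᵢ‖ ≤ 2862000 B ((t−σ)^{-1/2} − (t'−σ)^{-1/2})` for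
`σ < t ≤ t'` (the tree's modulus of continuity of `𝒩_τ` in `τ`, `3 · 954000`). [folklore] -/
theorem norm_sum_oseenHeat_sub_oseenHeat_smul_le
    (hmeas : ∀ j k, Measurable fun q : ℝ × E => F q.1 j k q.2) {B : ℝ} (hB0 : 0 ≤ B) {σ t t' : ℝ}
    (hσt : σ < t) (htt' : t ≤ t') (hB : ∀ j k y, |F σ j k y| ≤ B) (x : E) :
    ‖∑ i, (oseenHeat (t' - σ) (F σ) i x - oseenHeat (t - σ) (F σ) i x) • stdOrthonormalBasis ℝ E i‖
      ≤ 2862000 * B * ((t - σ) ^ (-(1 / 2 : ℝ)) - (t' - σ) ^ (-(1 / 2 : ℝ))) := by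
  have hF : ∀ j k, MemLp (F σ j k) ∞ volume := fun j k => (memLp_top_slice_of_bound hmeas hB j k).1
  have hB' : ∀ j k, eLpNorm (F σ j k) ∞ volume ≤ ENNReal.ofReal B := fun j k =>
    (memLp_top_slice_of_bound hmeas hB j k).2
  refine (norm_sum_smul_stdOrthonormalBasis_le _).trans ?_
  calc ∑ i, |oseenHeat (t' - σ) (F σ) i x - oseenHeat (t - σ) (F σ) i x|
      ≤ ∑ _i : Fin (Module.finrank ℝ E),
          954000 * B * ((t - σ) ^ (-(1 / 2 : ℝ)) - (t' - σ) ^ (-(1 / 2 : ℝ))) :=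
        Finset.sum_le_sum fun i _ => by
          rw [← Real.norm_eq_abs]
          exact norm_oseenHeat_sub_le hE hF hB0 hB' (sub_pos.2 hσt) (by linarith) i x
    _ = 2862000 * B * ((t - σ) ^ (-(1 / 2 : ℝ)) - (t' - σ) ^ (-(1 / 2 : ℝ))) := by
        rw [Finset.sum_const, Finset.card_univ, Fintype.card_fin, hE, nsmul_eq_mul]
        push_cast
        ring

omit hE in
/-- `∫ₛᵗ ((t−σ)^{-1/2} − (t'−σ)^{-1/2}) dσ ≤ 2 (t'−t)^{1/2}` for `s ≤ t ≤ t'`. [folklore] -/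
theorem integral_rpow_neg_half_sub_sub_le {s t t' : ℝ} (hst : s ≤ t) (htt' : t ≤ t') :
    ∫ σ in s..t, ((t - σ) ^ (-(1 / 2 : ℝ)) - (t' - σ) ^ (-(1 / 2 : ℝ))) ≤ 2 * (t' - t) ^ (1 / 2 : ℝ) := by
  rw [intervalIntegral.integral_sub (intervalIntegrable_rpow_neg_half_sub s t t)
    (intervalIntegrable_rpow_neg_half_sub s t t'), integral_rpow_neg_half_sub_eq s t]
  -- `∫ₛᵗ (t'−σ)^{-1/2} dσ = 2 ((t'−s)^{1/2} − (t'−t)^{1/2})`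
  have h2 : ∫ σ in s..t, (t' - σ) ^ (-(1 / 2 : ℝ)) = 2 * ((t' - s) ^ (1 / 2 : ℝ) - (t' - t) ^ (1 / 2 : ℝ)) := by
    rw [intervalIntegral.integral_comp_sub_left (fun σ => σ ^ (-(1 / 2 : ℝ))) t',
      integral_rpow (Or.inl (by norm_num : (-1 : ℝ) < -(1 / 2)))]
    rw [show (-(1 / 2 : ℝ)) + 1 = 1 / 2 by norm_num]
    ring
  rw [h2]
  have hmono : (t - s) ^ (1 / 2 : ℝ) ≤ (t' - s) ^ (1 / 2 : ℝ) :=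
    Real.rpow_le_rpow (by linarith) (by linarith) (by norm_num)
  nlinarith [Real.rpow_nonneg (show (0:ℝ) ≤ t' - t by linarith) (1 / 2 : ℝ)]

/-- **Hölder-`1/2` continuity in the observation time**: for `s ≤ t ≤ t'` and `F` bounded by `B`
on `(s, t')`,
`‖∫ₛ^{t'} 𝒩_{t'−σ}F(σ)(x) dσ − ∫ₛᵗ 𝒩_{t−σ}F(σ)(x) dσ‖ ≤ 5741658 B (t' − t)^{1/2}` (change of the
kernel time on `[s, t]` plus the short piece `[t, t']`; `2 · 2862000 + 17658`). [folklore] -/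
theorem norm_integral_sum_oseenHeat_duhamel_sub_le
    (hmeas : ∀ j k, Measurable fun q : ℝ × E => F q.1 j k q.2) {B : ℝ} (hB0 : 0 ≤ B) {s t t' : ℝ}
    (hst : s ≤ t) (htt' : t ≤ t') (hB : ∀ σ ∈ Ioo s t', ∀ j k y, |F σ j k y| ≤ B) (x : E) :
    ‖(∫ σ in s..t', ∑ i, oseenHeat (t' - σ) (F σ) i x • stdOrthonormalBasis ℝ E i) -
        ∫ σ in s..t, ∑ i, oseenHeat (t - σ) (F σ) i x • stdOrthonormalBasis ℝ E i‖ ≤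
      5741658 * B * (t' - t) ^ (1 / 2 : ℝ) := by
  set e := stdOrthonormalBasis ℝ E
  have hBt : ∀ σ ∈ Ioo s t, ∀ j k y, |F σ j k y| ≤ B := fun σ hσ =>
    hB σ ⟨hσ.1, lt_of_lt_of_le hσ.2 htt'⟩
  have hBt' : ∀ σ ∈ Ioo t t', ∀ j k y, |F σ j k y| ≤ B := fun σ hσ =>
    hB σ ⟨lt_of_le_of_lt hst hσ.1, hσ.2⟩
  -- integrability of the three integrands
  have i1 : IntervalIntegrable (fun σ => ∑ i, oseenHeat (t' - σ) (F σ) i x • e i) volume s t :=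
    intervalIntegrable_sum_oseenHeat_sub_smul_of_le hE hmeas hB0 hst htt' hBt x
  have i2 : IntervalIntegrable (fun σ => ∑ i, oseenHeat (t' - σ) (F σ) i x • e i) volume t t' :=
    intervalIntegrable_sum_oseenHeat_sub_smul hE hmeas hB0 htt' hBt' x
  have i3 : IntervalIntegrable (fun σ => ∑ i, oseenHeat (t - σ) (F σ) i x • e i) volume s t :=
    intervalIntegrable_sum_oseenHeat_sub_smul hE hmeas hB0 hst hBt x
  rw [← intervalIntegral.integral_add_adjacent_intervals i1 i2, add_sub_right_comm,
    ← intervalIntegral.integral_sub i1 i3]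
  have hsub : ∀ σ, (∑ i, oseenHeat (t' - σ) (F σ) i x • e i) - ∑ i, oseenHeat (t - σ) (F σ) i x • e i =
      ∑ i, (oseenHeat (t' - σ) (F σ) i x - oseenHeat (t - σ) (F σ) i x) • e i := fun σ => by
    rw [← Finset.sum_sub_distrib]
    exact Finset.sum_congr rfl fun i _ => (sub_smul _ _ _).symm
  simp_rw [hsub]
  -- the first piece
  have h1 : ‖∫ σ in s..t, ∑ i, (oseenHeat (t' - σ) (F σ) i x - oseenHeat (t - σ) (F σ) i x) • e i‖ ≤
      2862000 * B * (2 * (t' - t) ^ (1 / 2 : ℝ)) := by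
    have h := intervalIntegral.norm_integral_le_of_norm_le (μ := volume) (a := s) (b := t)
      (f := fun σ => ∑ i, (oseenHeat (t' - σ) (F σ) i x - oseenHeat (t - σ) (F σ) i x) • e i)
      (g := fun σ : ℝ => 2862000 * B * ((t - σ) ^ (-(1 / 2 : ℝ)) - (t' - σ) ^ (-(1 / 2 : ℝ)))) hst
      (ae_mem_Ioc_of_forall_Ioo fun σ hσ =>
        norm_sum_oseenHeat_sub_oseenHeat_smul_le hE hmeas hB0 hσ.2 htt' (hBt σ hσ) x)
      (((intervalIntegrable_rpow_neg_half_sub s t t).sub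
        (intervalIntegrable_rpow_neg_half_sub s t t')).const_mul _)
    refine h.trans ?_
    rw [intervalIntegral.integral_const_mul]
    exact mul_le_mul_of_nonneg_left (integral_rpow_neg_half_sub_sub_le hst htt') (by positivity)
  -- the second piece
  have h2 : ‖∫ σ in t..t', ∑ i, oseenHeat (t' - σ) (F σ) i x • e i‖ ≤ 17658 * B * (t' - t) ^ (1 / 2 : ℝ) :=
    norm_integral_sum_oseenHeat_sub_smul_le hE hmeas hB0 htt' hBt' x
  calc _ ≤ ‖∫ σ in s..t, ∑ i, (oseenHeat (t' - σ) (F σ) i x - oseenHeat (t - σ) (F σ) i x) • e i‖ +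
        ‖∫ σ in t..t', ∑ i, oseenHeat (t' - σ) (F σ) i x • e i‖ := norm_add_le _ _
    _ ≤ 2862000 * B * (2 * (t' - t) ^ (1 / 2 : ℝ)) + 17658 * B * (t' - t) ^ (1 / 2 : ℝ) :=
        add_le_add h1 h2
    _ = 5741658 * B * (t' - t) ^ (1 / 2 : ℝ) := by ring

/-- **Joint continuity of the Duhamel integral** `(t, x) ↦ ∫ₛᵗ 𝒩_{t−σ} F(σ)(x) dσ` on
`[s, T] × E` for a forcing bounded on `(s, T)` (Hölder-`1/2` in `t` uniformly in `x`, continuous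
in `x` at fixed `t`); in particular it is Borel measurable there. [folklore] -/
theorem continuousOn_integral_sum_oseenHeat_duhamel_prod
    (hmeas : ∀ j k, Measurable fun q : ℝ × E => F q.1 j k q.2) {B : ℝ} (hB0 : 0 ≤ B) {s T : ℝ}
    (hB : ∀ σ ∈ Ioo s T, ∀ j k y, |F σ j k y| ≤ B) :
    ContinuousOn (fun q : ℝ × E => ∫ σ in s..q.1, ∑ i, oseenHeat (q.1 - σ) (F σ) i q.2 •
      stdOrthonormalBasis ℝ E i) (Icc s T ×ˢ univ) := by
  set e := stdOrthonormalBasis ℝ E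
  set D : ℝ → E → E := fun t x => ∫ σ in s..t, ∑ i, oseenHeat (t - σ) (F σ) i x • e i with hD
  -- uniform Hölder bound in time
  have hH : ∀ t ∈ Icc s T, ∀ t' ∈ Icc s T, ∀ x, ‖D t' x - D t x‖ ≤ 5741658 * B * |t' - t| ^ (1 / 2 : ℝ) := by
    have key : ∀ t ∈ Icc s T, ∀ t' ∈ Icc s T, t ≤ t' → ∀ x,
        ‖D t' x - D t x‖ ≤ 5741658 * B * |t' - t| ^ (1 / 2 : ℝ) := by
      intro t ht t' ht' htt' x
      rw [abs_of_nonneg (sub_nonneg.2 htt')]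
      exact norm_integral_sum_oseenHeat_duhamel_sub_le hE hmeas hB0 ht.1 htt'
        (fun σ hσ => hB σ ⟨hσ.1, lt_of_lt_of_le hσ.2 ht'.2⟩) x
    intro t ht t' ht' x
    rcases le_total t t' with h | h
    · exact key t ht t' ht' h x
    · rw [← norm_neg, neg_sub, abs_sub_comm]
      exact key t' ht' t ht h x
  rintro ⟨t₀, x₀⟩ ⟨ht₀, -⟩
  rw [Metric.continuousWithinAt_iff]
  intro ε hε
  -- continuity in `x` at the fixed time `t₀`
  have hcx : Continuous (D t₀) := continuous_integral_sum_oseenHeat_duhamel hE hmeas hB0 ht₀.1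
    (fun σ hσ => hB σ ⟨hσ.1, lt_of_lt_of_le hσ.2 ht₀.2⟩)
  obtain ⟨δ₁, hδ₁, hδ₁ε⟩ := Metric.continuous_iff.1 hcx x₀ (ε / 2) (half_pos hε)
  set K : ℝ := 5741658 * B + 1 with hK
  have hK0 : 0 < K := by rw [hK]; positivity
  set δ₂ : ℝ := (ε / (2 * K)) ^ 2 with hδ₂
  have hδ₂0 : 0 < δ₂ := by rw [hδ₂]; positivity
  refine ⟨min δ₁ δ₂, lt_min hδ₁ hδ₂0, ?_⟩
  rintro ⟨t, x⟩ ⟨ht, -⟩ hdist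
  have hd1 : dist x x₀ < δ₁ := by
    have h1 : dist x x₀ ≤ dist (t, x) (t₀, x₀) := by
      rw [Prod.dist_eq]; exact le_max_right _ _
    exact lt_of_le_of_lt h1 (lt_of_lt_of_le hdist (min_le_left _ _))
  have hd2 : |t - t₀| < δ₂ := by
    have h1 : dist t t₀ ≤ dist (t, x) (t₀, x₀) := by
      rw [Prod.dist_eq]; exact le_max_left _ _
    have := lt_of_le_of_lt h1 (lt_of_lt_of_le hdist (min_le_right _ _))
    rwa [Real.dist_eq] at this
  -- time increment
  have hA : ‖D t x - D t₀ x‖ < ε / 2 := by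
    have h1 := hH t₀ ht₀ t ht x
    have h2 : |t - t₀| ^ (1 / 2 : ℝ) < ε / (2 * K) := by
      have hlt : |t - t₀| ^ (1 / 2 : ℝ) < δ₂ ^ (1 / 2 : ℝ) :=
        Real.rpow_lt_rpow (abs_nonneg _) hd2 (by norm_num)
      have heq : δ₂ ^ (1 / 2 : ℝ) = ε / (2 * K) := by
        rw [hδ₂, ← Real.sqrt_eq_rpow, Real.sqrt_sq (by positivity)]
      rwa [heq] at hlt
    have h3 : 5741658 * B * |t - t₀| ^ (1 / 2 : ℝ) ≤ K * |t - t₀| ^ (1 / 2 : ℝ) :=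
      mul_le_mul_of_nonneg_right (by rw [hK]; linarith) (Real.rpow_nonneg (abs_nonneg _) _)
    have h4 : K * |t - t₀| ^ (1 / 2 : ℝ) < K * (ε / (2 * K)) := mul_lt_mul_of_pos_left h2 hK0
    have h5 : K * (ε / (2 * K)) = ε / 2 := by field_simp
    linarith
  have hBx : ‖D t₀ x - D t₀ x₀‖ < ε / 2 := by rw [← dist_eq_norm]; exact hδ₁ε x hd1
  calc dist (D t x) (D t₀ x₀) = ‖(D t x - D t₀ x) + (D t₀ x - D t₀ x₀)‖ := by
        rw [dist_eq_norm, sub_add_sub_cancel]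
    _ ≤ ‖D t x - D t₀ x‖ + ‖D t₀ x - D t₀ x₀‖ := norm_add_le _ _
    _ < ε / 2 + ε / 2 := add_lt_add hA hBx
    _ = ε := add_halves ε

end Time

/-! ## Restart: `e^{(t−s)Δ} ∫ᵣˢ 𝒩_{s−σ}F(σ) dσ = ∫ᵣˢ 𝒩_{t−σ}F(σ) dσ` -/

section Restart

variable {E : Type*} [NormedAddCommGroup E] [InnerProductSpace ℝ E] [FiniteDimensional ℝ E]
  [MeasurableSpace E] [BorelSpace E]

variable (hE : Module.finrank ℝ E = 3)
include hE

variable {F : ℝ → Fin (Module.finrank ℝ E) → Fin (Module.finrank ℝ E) → E → ℝ}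

/-- For each `σ < s < t`: `e^{(t−s)Δ}` applied to the vector `∑ᵢ (𝒩_{s−σ}F(σ))ᵢ eᵢ` is
`∑ᵢ (𝒩_{t−σ}F(σ))ᵢ eᵢ` (semigroup law `heatExtension_oseenHeat`, componentwise). [folklore] -/
theorem integral_heatKernel_smul_sum_oseenHeat_smul
    (hmeas : ∀ j k, Measurable fun q : ℝ × E => F q.1 j k q.2) {B : ℝ} {σ s t : ℝ}
    (hσs : σ < s) (hst : s < t) (hB : ∀ j k y, |F σ j k y| ≤ B) (x : E) :
    ∫ y, UnboundedOperators.heatKernel (t - s) (x - y) •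
        ∑ i, oseenHeat (s - σ) (F σ) i y • stdOrthonormalBasis ℝ E i =
      ∑ i, oseenHeat (t - σ) (F σ) i x • stdOrthonormalBasis ℝ E i := by
  set e := stdOrthonormalBasis ℝ E
  have hF : ∀ j k, MemLp (F σ j k) ∞ volume := fun j k => (memLp_top_slice_of_bound hmeas hB j k).1
  have hts : 0 < t - s := sub_pos.2 hst
  have hsσ : 0 < s - σ := sub_pos.2 hσs
  -- integrability of each component against the kernel
  have hint : ∀ i, Integrable fun y => UnboundedOperators.heatKernel (t - s) (x - y) *
      oseenHeat (s - σ) (F σ) i y := by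
    intro i
    have hK : Integrable fun y => UnboundedOperators.heatKernel (t - s) (x - y) :=
      (UnboundedOperators.integrable_heatKernel_holds hts).comp_sub_left x
    obtain ⟨B', hB'0, hB'⟩ := exists_componentwise_bound hF
    refine hK.mul_bdd (aestronglyMeasurable_oseenHeat hE hF hsσ i) (Eventually.of_forall fun y =>
      norm_oseenHeat_le_of_top hE hF hB'0 hB' hsσ i y)
  have h1 : (fun y => UnboundedOperators.heatKernel (t - s) (x - y) • ∑ i, oseenHeat (s - σ) (F σ) i y • e i)
      = fun y => ∑ i, (UnboundedOperators.heatKernel (t - s) (x - y) * oseenHeat (s - σ) (F σ) i y) • e i := by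
    funext y
    rw [Finset.smul_sum]
    exact Finset.sum_congr rfl fun i _ => smul_smul _ _ _
  rw [h1, integral_finsetSum _ fun i _ => (hint i).smul_const _]
  refine Finset.sum_congr rfl fun i _ => ?_
  rw [integral_smul_const]
  congr 1
  have h2 : ∫ y, UnboundedOperators.heatKernel (t - s) (x - y) * oseenHeat (s - σ) (F σ) i y =
      UnboundedOperators.heatExtension (oseenHeat (s - σ) (F σ) i) (t - s) x := by
    rw [UnboundedOperators.heatExtension_eq_integral_sub]
    rfl
  rw [h2, heatExtension_oseenHeat hE hF hts hsσ i x]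
  congr 1
  ring

/-- **Restart of the Duhamel integral through the heat semigroup**: for `r ≤ s < t` and a forcing
bounded on `(r, s)`, `e^{(t−s)Δ}(∫ᵣˢ 𝒩_{s−σ}F(σ) dσ)(x) = ∫ᵣˢ 𝒩_{t−σ}F(σ)(x) dσ` (Fubini in
`(y, σ)`: the double integrand is dominated by `G_{t−s}(x−y) · 8829 (s−σ)^{-1/2} B`, then the
componentwise semigroup law). [folklore] -/
theorem heatExtension_integral_sum_oseenHeat_duhamel
    (hmeas : ∀ j k, Measurable fun q : ℝ × E => F q.1 j k q.2) {B : ℝ} (hB0 : 0 ≤ B) {r s t : ℝ}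
    (hrs : r ≤ s) (hst : s < t) (hB : ∀ σ ∈ Ioo r s, ∀ j k y, |F σ j k y| ≤ B) (x : E) :
    UnboundedOperators.heatExtension
        (fun y => ∫ σ in r..s, ∑ i, oseenHeat (s - σ) (F σ) i y • stdOrthonormalBasis ℝ E i)
        (t - s) x =
      ∫ σ in r..s, ∑ i, oseenHeat (t - σ) (F σ) i x • stdOrthonormalBasis ℝ E i := by
  set e := stdOrthonormalBasis ℝ E
  have hts : 0 < t - s := sub_pos.2 hst
  rw [UnboundedOperators.heatExtension_eq_integral_sub]
  simp_rw [intervalIntegral.integral_of_le hrs]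
  -- the double integrand and its integrability on `E × Ioc r s`
  set μσ : Measure ℝ := volume.restrict (Ioc r s) with hμσ
  have hμσ' : μσ = volume.restrict (Ioo r s) := by
    rw [hμσ, Measure.restrict_congr_set Ioo_ae_eq_Ioc]
  set Φ : E × ℝ → E := fun q => UnboundedOperators.heatKernel (t - s) (x - q.1) •
    ∑ i, oseenHeat (s - q.2) (F q.2) i q.1 • e i with hΦ
  have hvec : AEStronglyMeasurable (fun q : ℝ × E => ∑ i, oseenHeat (s - q.1) (F q.1) i q.2 • e i)
      (μσ.prod (volume : Measure E)) := by
    rw [hμσ']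
    exact Finset.aestronglyMeasurable_fun_sum _ fun i _ =>
      (aestronglyMeasurable_oseenHeat_clock_prod hmeas measurableSet_Ioo hB
        (measurable_const.sub measurable_id) (fun σ hσ => sub_pos.2 hσ.2) i).smul_const _
  have hK : Measurable fun y : E => UnboundedOperators.heatKernel (t - s) (x - y) :=
    (UnboundedOperators.continuous_heatKernel (E := E) (t - s)).measurable.comp
      (measurable_const.sub measurable_id)
  have hΦm : AEStronglyMeasurable Φ ((volume : Measure E).prod μσ) :=
    (hK.comp measurable_fst).aestronglyMeasurable.smul hvec.prod_swap
  have hΦi : Integrable Φ ((volume : Measure E).prod μσ) := by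
    have hmaj : Integrable (fun q : E × ℝ => UnboundedOperators.heatKernel (t - s) (x - q.1) *
        (8829 * (s - q.2) ^ (-(1 / 2 : ℝ)) * B)) ((volume : Measure E).prod μσ) := by
      have h1 : Integrable (fun y : E => UnboundedOperators.heatKernel (t - s) (x - y)) volume :=
        (UnboundedOperators.integrable_heatKernel_holds hts).comp_sub_left x
      have h2 : Integrable (fun σ : ℝ => 8829 * (s - σ) ^ (-(1 / 2 : ℝ)) * B) μσ := by
        rw [hμσ]
        exact (intervalIntegrable_iff_integrableOn_Ioc_of_le hrs).1
          (((intervalIntegrable_rpow_neg_half_sub r s s).const_mul 8829).mul_const B)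
      exact h1.mul_prod h2
    refine hmaj.mono' hΦm ?_
    have hae : ∀ᵐ q ∂((volume : Measure E).prod μσ), q.2 ∈ Ioo r s := by
      refine (Measure.quasiMeasurePreserving_snd (μ := (volume : Measure E)) (ν := μσ)).ae ?_
      rw [hμσ']
      exact ae_restrict_mem measurableSet_Ioo
    filter_upwards [hae] with q hq
    rw [hΦ]
    dsimp only
    rw [norm_smul, Real.norm_eq_abs, abs_of_nonneg (UnboundedOperators.heatKernel_pos hts _).le]
    exact mul_le_mul_of_nonneg_left
      (norm_sum_oseenHeat_duhamelIntegrand_smul_le hE hmeas hB0 hq.2 (hB q.2 hq) q.1)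
      (UnboundedOperators.heatKernel_pos hts _).le
  -- pull the kernel inside and swap
  have hL : ∀ y, UnboundedOperators.heatKernel (t - s) (x - y) • (∫ σ in Ioc r s, ∑ i,
      oseenHeat (s - σ) (F σ) i y • e i) = ∫ σ in Ioc r s, Φ (y, σ) := fun y => by
    rw [← integral_smul]
  rw [show (fun y => UnboundedOperators.heatKernel (t - s) (x - y) • ∫ σ in Ioc r s, ∑ i,
      oseenHeat (s - σ) (F σ) i y • e i) = fun y => ∫ σ in Ioc r s, Φ (y, σ) from funext hL]
  rw [integral_integral_swap (f := fun y σ => Φ (y, σ)) hΦi]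
  -- evaluate the inner integral for a.e. `σ`
  refine setIntegral_congr_ae measurableSet_Ioc ?_
  refine (ae_mem_Ioc_of_forall_Ioo fun σ hσ => ?_)
  exact integral_heatKernel_smul_sum_oseenHeat_smul hE hmeas hσ.2 hst (hB σ hσ) x

/-- **Restart identity for the Duhamel integral**: for `r ≤ s < t` and a forcing bounded on
`(r, t)`, `∫ᵣᵗ 𝒩_{t−σ}F(σ)(x) dσ = e^{(t−s)Δ}(∫ᵣˢ 𝒩_{s−σ}F(σ) dσ)(x) + ∫ₛᵗ 𝒩_{t−σ}F(σ)(x) dσ`.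
[folklore] -/
theorem integral_sum_oseenHeat_duhamel_eq_heatExtension_add
    (hmeas : ∀ j k, Measurable fun q : ℝ × E => F q.1 j k q.2) {B : ℝ} (hB0 : 0 ≤ B) {r s t : ℝ}
    (hrs : r ≤ s) (hst : s < t) (hB : ∀ σ ∈ Ioo r t, ∀ j k y, |F σ j k y| ≤ B) (x : E) :
    ∫ σ in r..t, ∑ i, oseenHeat (t - σ) (F σ) i x • stdOrthonormalBasis ℝ E i =
      UnboundedOperators.heatExtension
          (fun y => ∫ σ in r..s, ∑ i, oseenHeat (s - σ) (F σ) i y • stdOrthonormalBasis ℝ E i)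
          (t - s) x +
        ∫ σ in s..t, ∑ i, oseenHeat (t - σ) (F σ) i x • stdOrthonormalBasis ℝ E i := by
  have hBrs : ∀ σ ∈ Ioo r s, ∀ j k y, |F σ j k y| ≤ B := fun σ hσ =>
    hB σ ⟨hσ.1, lt_trans hσ.2 hst⟩
  have hBst : ∀ σ ∈ Ioo s t, ∀ j k y, |F σ j k y| ≤ B := fun σ hσ =>
    hB σ ⟨lt_of_le_of_lt hrs hσ.1, hσ.2⟩
  rw [heatExtension_integral_sum_oseenHeat_duhamel hE hmeas hB0 hrs hst hBrs x,
    intervalIntegral.integral_add_adjacent_intervals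
      (intervalIntegrable_sum_oseenHeat_sub_smul_of_le hE hmeas hB0 hrs hst.le hBrs x)
      (intervalIntegrable_sum_oseenHeat_sub_smul hE hmeas hB0 hst.le hBst x)]

end Restart

/-! ## Almost-everywhere equal forcings give the same Duhamel integral -/

section Congr

variable {E : Type*} [NormedAddCommGroup E] [InnerProductSpace ℝ E] [FiniteDimensional ℝ E]
  [MeasurableSpace E] [BorelSpace E]
variable {F' : Type*} [NormedAddCommGroup F'] [NormedSpace ℝ F']

/-- Almost everywhere equal data have the same caloric extension **everywhere** (the heat
extension is a convolution integral; translation invariance of Lebesgue measure). The same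
statement is proved in `MildL3Smooth.lean` (`heatExtension_congr_ae`), which is not imported here.
[folklore] -/
theorem heatExtension_eq_of_ae_eq {f g : E → F'} (hfg : f =ᵐ[volume] g) (t : ℝ) :
    UnboundedOperators.heatExtension f t = UnboundedOperators.heatExtension g t := by
  funext x
  rw [UnboundedOperators.heatExtension_apply, UnboundedOperators.heatExtension_apply]
  refine integral_congr_ae ?_
  have h : (fun y => f (x - y)) =ᵐ[volume] fun y => g (x - y) :=
    (Measure.measurePreserving_sub_left volume x).quasiMeasurePreserving.ae_eq_comp hfg
  filter_upwards [h] with y hy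
  rw [hy]

/-- `heatD1`, `heatD3` and `oseenHeat` only see the a.e. class of the data. [folklore] -/
theorem heatD1_eq_of_ae_eq {φ ψ : E → ℝ} (h : φ =ᵐ[volume] ψ) (s : ℝ) (v : E) :
    heatD1 s v φ = heatD1 s v ψ := by
  funext x
  simp only [heatD1, heatExtension_eq_of_ae_eq h]

/-- `heatD3` only sees the a.e. class of the data. [folklore] -/
theorem heatD3_eq_of_ae_eq {φ ψ : E → ℝ} (h : φ =ᵐ[volume] ψ) (s : ℝ) (u v w : E) :
    heatD3 s u v w φ = heatD3 s u v w ψ := by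
  funext x
  simp only [heatD3, heatExtension_eq_of_ae_eq h]

/-- **`𝒩_τ F` only sees the a.e. class of `F`** (componentwise). [folklore] -/
theorem oseenHeat_eq_of_ae_eq {F G : Fin (Module.finrank ℝ E) → Fin (Module.finrank ℝ E) → E → ℝ}
    (h : ∀ j k, F j k =ᵐ[volume] G j k) (τ : ℝ) (i : Fin (Module.finrank ℝ E)) :
    oseenHeat τ F i = oseenHeat τ G i := by
  funext x
  unfold oseenHeat
  congr 1
  · exact Finset.sum_congr rfl fun j _ => by rw [heatD1_eq_of_ae_eq (h j i)]
  · refine Finset.sum_congr rfl fun j _ => Finset.sum_congr rfl fun k _ => ?_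
    refine integral_congr_ae (Eventually.of_forall fun σ => ?_)
    dsimp only
    rw [heatD3_eq_of_ae_eq (h j k)]

/-- **Duhamel integrals of a.e.-equal forcings agree everywhere**: if `F(σ)ⱼₖ = G(σ)ⱼₖ` a.e.
in space for a.e. `σ ∈ (r, t)` (`r ≤ t`), then `∫ᵣᵗ 𝒩_{t−σ}F(σ)(x) dσ = ∫ᵣᵗ 𝒩_{t−σ}G(σ)(x) dσ` for every `x`.
[folklore] -/
theorem integral_sum_oseenHeat_duhamel_congr_ae
    {F G : ℝ → Fin (Module.finrank ℝ E) → Fin (Module.finrank ℝ E) → E → ℝ} {r t : ℝ} (hrt : r ≤ t)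
    (h : ∀ᵐ σ ∂(volume.restrict (Ioo r t)), ∀ j k, F σ j k =ᵐ[volume] G σ j k) (x : E) :
    ∫ σ in r..t, ∑ i, oseenHeat (t - σ) (F σ) i x • stdOrthonormalBasis ℝ E i =
      ∫ σ in r..t, ∑ i, oseenHeat (t - σ) (G σ) i x • stdOrthonormalBasis ℝ E i := by
  refine intervalIntegral.integral_congr_ae ?_
  rw [uIoc_of_le hrt]
  have h' : ∀ᵐ σ ∂(volume : Measure ℝ), σ ∈ Ioo r t → ∀ j k, F σ j k =ᵐ[volume] G σ j k :=
    (ae_restrict_iff' measurableSet_Ioo).1 h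
  have hne : ∀ᵐ σ ∂(volume : Measure ℝ), σ ≠ t := by
    have h0 : (volume : Measure ℝ) {t} = 0 := measure_singleton t
    exact (ae_iff.2 (by simp [h0]))
  filter_upwards [h', hne] with σ hσ hσt hmem
  have hσ' := hσ ⟨hmem.1, lt_of_le_of_ne hmem.2 hσt⟩
  exact Finset.sum_congr rfl fun i _ => by rw [oseenHeat_eq_of_ae_eq hσ']

end Congr

/-! ## Specialisation to the drift tensor `(U + b) ⊗ (U + b)` and `driftDuhamel` -/

section Drift

variable {E : Type*} [NormedAddCommGroup E] [InnerProductSpace ℝ E] [FiniteDimensional ℝ E]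
  [MeasurableSpace E] [BorelSpace E]

/-- The drift tensor of jointly measurable `U` and measurable `b` is jointly measurable in
`(σ, y)`. [folklore] -/
theorem measurable_driftTensor {U : ℝ → E → E} {b : ℝ → E} (hU : Measurable (uncurry U))
    (hb : Measurable b) (j k : Fin (Module.finrank ℝ E)) :
    Measurable fun q : ℝ × E => driftTensor U b q.1 j k q.2 := by
  have hsum : Measurable fun q : ℝ × E => U q.1 q.2 + b q.1 := hU.add (hb.comp measurable_fst)
  simp only [driftTensor_apply]
  exact (hsum.inner measurable_const).mul (hsum.inner measurable_const)

omit [MeasurableSpace E] [BorelSpace E] in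
/-- Size of the drift tensor: `|((U + b) ⊗ (U + b))ⱼₖ(σ, y)| ≤ 4N²` when `‖U σ y‖, ‖b σ‖ ≤ N`.
[folklore] -/
theorem abs_driftTensor_le {U : ℝ → E → E} {b : ℝ → E} {N : ℝ} {σ : ℝ} {y : E}
    (hU : ‖U σ y‖ ≤ N) (hb : ‖b σ‖ ≤ N) (j k : Fin (Module.finrank ℝ E)) :
    |driftTensor U b σ j k y| ≤ 4 * N ^ 2 := by
  rw [driftTensor_apply, abs_mul]
  have h1 := abs_inner_stdOrthonormalBasis_le (U σ y + b σ) j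
  have h2 := abs_inner_stdOrthonormalBasis_le (U σ y + b σ) k
  have h3 : ‖U σ y + b σ‖ ≤ 2 * N := (norm_add_le _ _).trans (by linarith)
  have h0 : 0 ≤ ‖U σ y + b σ‖ := norm_nonneg _
  calc |⟪U σ y + b σ, stdOrthonormalBasis ℝ E j⟫| * |⟪U σ y + b σ, stdOrthonormalBasis ℝ E k⟫|
      ≤ (2 * N) * (2 * N) :=
        mul_le_mul (h1.trans h3) (h2.trans h3) (abs_nonneg _) (by linarith)
    _ = 4 * N ^ 2 := by ring

namespace IsKNSSDriftMild

variable {T N : ℝ} {U : ℝ → E → E} {b : ℝ → E}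

/-- The drift tensor of a drift-mild pair is bounded by `4N²` on the window. [folklore] -/
theorem abs_driftTensor_le (h : IsKNSSDriftMild T N U b) {σ : ℝ} (hσ : σ ∈ Ioo 0 T)
    (j k : Fin (Module.finrank ℝ E)) (y : E) : |driftTensor U b σ j k y| ≤ 4 * N ^ 2 :=
  FluidPDE.abs_driftTensor_le (h.norm_le σ hσ y) (h.norm_drift_le σ) j k

/-- The drift tensor of a drift-mild pair is jointly measurable. [folklore] -/
theorem measurable_driftTensor (h : IsKNSSDriftMild T N U b) (j k : Fin (Module.finrank ℝ E)) :
    Measurable fun q : ℝ × E => driftTensor U b q.1 j k q.2 :=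
  FluidPDE.measurable_driftTensor h.measurable h.measurable_drift j k

/-- Every slice `U(t, ·)` of a drift-mild pair is in `L^∞` (it is measurable, and bounded on the
window). [folklore] -/
theorem memLp_top_slice (h : IsKNSSDriftMild T N U b) {t : ℝ} (ht : t ∈ Ioo 0 T) :
    MemLp (U t) ∞ volume :=
  memLp_top_of_bound (h.measurable.comp (measurable_const.prodMk measurable_id)).aestronglyMeasurable
    N (Eventually.of_forall fun y => h.norm_le t ht y)

variable (hE : Module.finrank ℝ E = 3)
include hE

/-- **Size of the drift Duhamel term**: `‖driftDuhamel U b s t x‖ ≤ 70632 N² (t − s)^{1/2}` for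
`0 ≤ s ≤ t ≤ T` (`17658 · 4`). [folklore] -/
theorem norm_driftDuhamel_le (h : IsKNSSDriftMild T N U b) {s t : ℝ} (hs : 0 ≤ s) (hst : s ≤ t)
    (ht : t ≤ T) (x : E) :
    ‖driftDuhamel U b s t x‖ ≤ 70632 * N ^ 2 * (t - s) ^ (1 / 2 : ℝ) := by
  rw [driftDuhamel_apply]
  have hB : ∀ σ ∈ Ioo s t, ∀ j k y, |driftTensor U b σ j k y| ≤ 4 * N ^ 2 := fun σ hσ j k y =>
    h.abs_driftTensor_le ⟨lt_of_le_of_lt hs hσ.1, lt_of_lt_of_le hσ.2 ht⟩ j k y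
  refine (norm_integral_sum_oseenHeat_sub_smul_le hE h.measurable_driftTensor (by positivity) hst
    hB x).trans (le_of_eq ?_)
  ring

/-- The drift Duhamel term is continuous in space. [folklore] -/
theorem continuous_driftDuhamel (h : IsKNSSDriftMild T N U b) {s t : ℝ} (hs : 0 ≤ s)
    (hst : s ≤ t) (ht : t ≤ T) : Continuous (driftDuhamel U b s t) := by
  have hB : ∀ σ ∈ Ioo s t, ∀ j k y, |driftTensor U b σ j k y| ≤ 4 * N ^ 2 := fun σ hσ j k y =>
    h.abs_driftTensor_le ⟨lt_of_le_of_lt hs hσ.1, lt_of_lt_of_le hσ.2 ht⟩ j k y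
  have hfun : driftDuhamel U b s t = fun x => ∫ σ in s..t, ∑ i,
      oseenHeat (t - σ) (driftTensor U b σ) i x • stdOrthonormalBasis ℝ E i := rfl
  rw [hfun]
  exact continuous_integral_sum_oseenHeat_duhamel hE h.measurable_driftTensor (by positivity)
    hst hB

/-- **Every slice of a drift-mild field in the open window is continuous** (it is a caloric
extension of a bounded slice minus a Duhamel term). [folklore] -/
theorem continuous_slice (h : IsKNSSDriftMild T N U b) {t : ℝ} (ht : t ∈ Ioo 0 T) :
    Continuous (U t) := by
  have hs : t / 2 ∈ Ioo 0 T := ⟨by linarith [ht.1], by linarith [ht.1, ht.2]⟩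
  have hfun : U t = fun x => UnboundedOperators.heatExtension (U (t / 2)) (t - t / 2) x -
      driftDuhamel U b (t / 2) t x := funext fun x => h.mild (t / 2) t hs.1 (by linarith [ht.1]) ht.2 x
  rw [hfun]
  refine Continuous.sub ?_ (h.continuous_driftDuhamel hE hs.1.le (by linarith [ht.1]) ht.2.le)
  exact (UnboundedOperators.contDiff_heatExtension_holds (h.memLp_top_slice hs) le_top
    (by linarith [ht.1] : 0 < t - t / 2)).continuous

/-- **Joint continuity of the drift Duhamel term** `(t, x) ↦ driftDuhamel U b s t x` on
`[s, T] × E` for `0 ≤ s`. [folklore] -/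
theorem continuousOn_driftDuhamel_prod (h : IsKNSSDriftMild T N U b) {s : ℝ} (hs : 0 ≤ s) :
    ContinuousOn (fun q : ℝ × E => driftDuhamel U b s q.1 q.2) (Icc s T ×ˢ univ) := by
  have hB : ∀ σ ∈ Ioo s T, ∀ j k y, |driftTensor U b σ j k y| ≤ 4 * N ^ 2 := fun σ hσ j k y =>
    h.abs_driftTensor_le ⟨lt_of_le_of_lt hs hσ.1, hσ.2⟩ j k y
  have := continuousOn_integral_sum_oseenHeat_duhamel_prod hE h.measurable_driftTensor
    (by positivity) hB
  simpa only [driftDuhamel] using this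

/-- **Restart of the drift Duhamel term**: for `0 ≤ r ≤ s < t ≤ T`,
`driftDuhamel U b r t x = e^{(t−s)Δ}(driftDuhamel U b r s)(x) + driftDuhamel U b s t x`. [folklore] -/
theorem driftDuhamel_eq_heatExtension_add (h : IsKNSSDriftMild T N U b) {r s t : ℝ} (hr : 0 ≤ r)
    (hrs : r ≤ s) (hst : s < t) (ht : t ≤ T) (x : E) :
    driftDuhamel U b r t x =
      UnboundedOperators.heatExtension (driftDuhamel U b r s) (t - s) x + driftDuhamel U b s t x := by
  have hB : ∀ σ ∈ Ioo r t, ∀ j k y, |driftTensor U b σ j k y| ≤ 4 * N ^ 2 := fun σ hσ j k y =>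
    h.abs_driftTensor_le ⟨lt_of_le_of_lt hr hσ.1, lt_of_lt_of_le hσ.2 ht⟩ j k y
  have hfun : driftDuhamel U b r s = fun y => ∫ σ in r..s, ∑ i,
      oseenHeat (s - σ) (driftTensor U b σ) i y • stdOrthonormalBasis ℝ E i := rfl
  rw [driftDuhamel_apply, driftDuhamel_apply, hfun]
  exact integral_sum_oseenHeat_duhamel_eq_heatExtension_add hE h.measurable_driftTensor
    (by positivity) hrs hst hB x

end IsKNSSDriftMild

end Drift

end Literature.Analysis.FluidPDE
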